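import Mathlib
import HarnessLib
import Summits.Ventures.LatticeQCDFlow.Exactness.SphereLatticeLaplacianSelfAdjoint

/-!
# The top label is attained: one-site solid harmonics `Re(⟪b_{i₀}, x_n⟫ + i⟪b_{i₁}, x_n⟫)^N` are eigenfunctions of Lüscher's operator with eigenvalue `N(N + d − 2)` — the Bernstein constant and (at `N = 1`) the gap `d − 1` are optimal for every volume

HONEST FRAMING: exact (Metropolis-corrected) sampling algorithms for lattice gauge theory;
figures of merit are autocorrelation/cost numbers at stated couplings and volumes; no
continuum-physics claim.

Venture `LatticeQCDFlow` (cell pub-lqcd), topic `Exactness`; FANOUT row 7 (`s0-cpn-null`: the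
S0-D1 rung — 2D CP⁹, Lüscher's LO trivializing map inside HMC, Engel–Schaefer 2011).  NEW WORK of
the cell over the tree's `Exactness/LatticeSitePolynomialOperator.lean` (`polyLap`, linearity of
the site operators), `Exactness/LatticeSiteDerivatives.lean` (`siteDeriv_scoord`, Leibniz) and
`Exactness/SphereLatticeLaplacianSelfAdjoint.lean` (`LΩ`, `inner_LΩ_self`, `norm_toV_sq`,
`bernstein_polyS`); nothing is cited as a fact.  Printed counterpart, NAMED ONLY: M. Lüscher,
Commun. Math. Phys. 293 (2010) 899, §3.3; Engel–Schaefer, Comput. Phys. Commun. 182 (2011) 2107,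
§3 (the display before eq. (15): site-linear functionals, the case `N = 1`).  That `Re (x₁ + i x₂)^N`
is a harmonic polynomial whose restriction to `S^{d−1}` is an eigenfunction of the Laplace–Beltrami
operator with eigenvalue `N(N + d − 2)` is classical; here it is obtained inside the tree's ambient
site calculus, by induction on `N`.

## Content (`E` finite-dimensional, `d = dim E`, frame `b`; `i₀ ≠ i₁` frame indices; `n₀ ∈ Λ`)

* `zpowPair`, `reZpow`, `imZpow` — `(R_N, I_N)` = real/imaginary parts of `(⟪b i₀, x n₀⟫ + i⟪b i₁, x n₀⟫)^N`
  by `R_{N+1} = a R_N − b I_N`, `I_{N+1} = a I_N + b R_N`; in `polyS N`, smooth, `R_N(x ≡ b i₀) = 1`.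
* `siteDeriv_zpow`, `siteEuler_reZpow` (`E_k R_N = δ_{n₀k} N R_N`), **`siteFlatLap_reZpow`**
  (HARMONICITY `Σ_i D²_{k,b_i} R_N = 0`), **`polyLap_reZpow`** (`𝔏 R_N = N(N + d − 2) · R_N`).
* **`hasEigenvalue_polyLap_top`** — `N(N + d − 2)` IS AN EIGENVALUE of `𝔏₀` on `polyS N` (`d ≥ 2`,
  `Λ` nonempty); **`exists_sphere_eigenfunction_top`** (on the spheres); **`bernstein_polyS_sharp`**
  — equality in the Bernstein inequality: `Σ_k ∫‖∂̃_k R_N‖² dπ = N(N+d−2) ∫ R_N² dπ`, `∫ R_N² dπ > 0`;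
  `gap_label_attained` (`N = 1`: the label `d − 1`).

NOT CLAIMED: the full list of attained labels or multiplicities; anything about flows or numbers.
-/

noncomputable section

namespace Summit.Ventures.LatticeQCDFlow.Exactness

open Function Set Metric MeasureTheory
open scoped RealInnerProductSpace ContDiff

variable {Λ : Type*} {E : Type*} [NormedAddCommGroup E] [InnerProductSpace ℝ E]
  [FiniteDimensional ℝ E]

/-! ## §1 The one-site solid harmonics `R_N`, `I_N` -/

section Harmonics

variable (n₀ : Λ) (i₀ i₁ : Fin (Module.finrank ℝ E))

/-- **`(R_N, I_N)`**: real and imaginary parts of `(⟪b i₀, x n₀⟫ + i ⟪b i₁, x n₀⟫)^N`, by the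
recursion `R_{N+1} = a R_N − b I_N`, `I_{N+1} = a I_N + b R_N` (`a = scoord (n₀, i₀)`,
`b = scoord (n₀, i₁)`). -/
def zpowPair : ℕ → ((Λ → E) → ℝ) × ((Λ → E) → ℝ)
  | 0 => (fun _ => 1, fun _ => 0)
  | N + 1 =>
    (scoord ((n₀, i₀) : SiteCoord Λ E) * (zpowPair N).1 -
        scoord ((n₀, i₁) : SiteCoord Λ E) * (zpowPair N).2,
      scoord ((n₀, i₀) : SiteCoord Λ E) * (zpowPair N).2 +
        scoord ((n₀, i₁) : SiteCoord Λ E) * (zpowPair N).1)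

/-- **`R_N = Re (a + i b)^N`** as a functional on `Λ → E`. -/
def reZpow (N : ℕ) : (Λ → E) → ℝ := (zpowPair n₀ i₀ i₁ N).1
/-- **`I_N = Im (a + i b)^N`** as a functional on `Λ → E`. -/
def imZpow (N : ℕ) : (Λ → E) → ℝ := (zpowPair n₀ i₀ i₁ N).2

/-- `R_0 = 1`. -/
@[simp] theorem reZpow_zero : reZpow n₀ i₀ i₁ 0 = fun _ => (1 : ℝ) := rfl
/-- `I_0 = 0`. -/
@[simp] theorem imZpow_zero : imZpow n₀ i₀ i₁ 0 = fun _ => (0 : ℝ) := rfl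

/-- `R_{N+1} = a R_N − b I_N`. -/
theorem reZpow_succ (N : ℕ) : reZpow n₀ i₀ i₁ (N + 1) =
    scoord ((n₀, i₀) : SiteCoord Λ E) * reZpow n₀ i₀ i₁ N -
      scoord ((n₀, i₁) : SiteCoord Λ E) * imZpow n₀ i₀ i₁ N := rfl

/-- `I_{N+1} = a I_N + b R_N`. -/
theorem imZpow_succ (N : ℕ) : imZpow n₀ i₀ i₁ (N + 1) =
    scoord ((n₀, i₀) : SiteCoord Λ E) * imZpow n₀ i₀ i₁ N +
      scoord ((n₀, i₁) : SiteCoord Λ E) * reZpow n₀ i₀ i₁ N := rfl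

/-- **`R_N, I_N ∈ polyS N`.** -/
theorem zpow_mem_polyS : ∀ N : ℕ,
    reZpow n₀ i₀ i₁ N ∈ polyS Λ E N ∧ imZpow n₀ i₀ i₁ N ∈ polyS Λ E N
  | 0 => ⟨one_mem_polyS 0, by rw [imZpow_zero]; exact const_mem_polyS 0 0⟩
  | N + 1 => by
      obtain ⟨hR, hI⟩ := zpow_mem_polyS N
      rw [reZpow_succ, imZpow_succ]
      exact ⟨Submodule.sub_mem _ (mul_mem_polyS_of_le (by omega) (scoord_mem_polyS le_rfl _) hR)
          (mul_mem_polyS_of_le (by omega) (scoord_mem_polyS le_rfl _) hI),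
        Submodule.add_mem _ (mul_mem_polyS_of_le (by omega) (scoord_mem_polyS le_rfl _) hI)
          (mul_mem_polyS_of_le (by omega) (scoord_mem_polyS le_rfl _) hR)⟩

/-- `R_N ∈ polyS N`. -/
theorem reZpow_mem_polyS (N : ℕ) : reZpow n₀ i₀ i₁ N ∈ polyS Λ E N := (zpow_mem_polyS n₀ i₀ i₁ N).1
/-- **At the configuration `x ≡ b i₀`: `R_N = 1`, `I_N = 0`** (`i₀ ≠ i₁`; `z = 1`). -/
theorem zpow_frame (h : i₀ ≠ i₁) : ∀ N : ℕ,
    reZpow n₀ i₀ i₁ N (fun _ => stdOrthonormalBasis ℝ E i₀) = 1 ∧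
      imZpow n₀ i₀ i₁ N (fun _ => stdOrthonormalBasis ℝ E i₀) = 0
  | 0 => by simp
  | N + 1 => by
      obtain ⟨hR, hI⟩ := zpow_frame h N
      have ha : scoord ((n₀, i₀) : SiteCoord Λ E) (fun _ => stdOrthonormalBasis ℝ E i₀) = 1 := by simp [scoord]
      have hb : scoord ((n₀, i₁) : SiteCoord Λ E) (fun _ => stdOrthonormalBasis ℝ E i₀) = 0 := by
        simp [scoord, (stdOrthonormalBasis ℝ E).inner_eq_ite, Ne.symm h]
      simp only [reZpow_succ, imZpow_succ, Pi.sub_apply, Pi.add_apply, Pi.mul_apply, ha, hb, hR, hI]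
      norm_num

variable [Fintype Λ]

/-- `R_N`, `I_N` are smooth. -/
theorem contDiff_zpow (N : ℕ) :
    ContDiff ℝ ∞ (reZpow n₀ i₀ i₁ N) ∧ ContDiff ℝ ∞ (imZpow n₀ i₀ i₁ N) :=
  ⟨contDiff_of_mem_polyS (zpow_mem_polyS n₀ i₀ i₁ N).1,
    contDiff_of_mem_polyS (zpow_mem_polyS n₀ i₀ i₁ N).2⟩

end Harmonics

/-! ## §2 Site derivatives of the solid harmonics; harmonicity -/

section Derivatives

variable [Fintype Λ] [DecidableEq Λ] (n₀ : Λ) (i₀ i₁ : Fin (Module.finrank ℝ E))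

omit [FiniteDimensional ℝ E] in
/-- Subtraction rule for the site derivative on smooth functionals. -/
theorem siteDeriv_sub_of_contDiff {F G : (Λ → E) → ℝ} (hF : ContDiff ℝ ∞ F) (hG : ContDiff ℝ ∞ G)
    (k : Λ) (v : E) : siteDeriv k v (F - G) = siteDeriv k v F - siteDeriv k v G := by
  have e : F - G = F + (-1 : ℝ) • G := by
    funext x; simp [sub_eq_add_neg]
  have hG' : ContDiff ℝ ∞ ((-1 : ℝ) • G) := hG.const_smul (-1 : ℝ)
  rw [e, siteDeriv_add_of_contDiff hF hG', siteDeriv_smul_of_contDiff hG]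
  funext x
  simp [sub_eq_add_neg]

omit [FiniteDimensional ℝ E] in
/-- `D_{k,v}(c₁ F − c₂ G) = c₁ D F − c₂ D G` pointwise, for smooth `F`, `G`. -/
theorem siteDeriv_smul_sub_smul {F G : (Λ → E) → ℝ} (hF : ContDiff ℝ ∞ F) (hG : ContDiff ℝ ∞ G)
    (c₁ c₂ : ℝ) (k : Λ) (v : E) (x : Λ → E) :
    siteDeriv k v (c₁ • F - c₂ • G) x = c₁ * siteDeriv k v F x - c₂ * siteDeriv k v G x := by
  have h1 : ContDiff ℝ ∞ (c₁ • F) := hF.const_smul c₁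
  have h2 : ContDiff ℝ ∞ (c₂ • G) := hG.const_smul c₂
  rw [siteDeriv_sub_of_contDiff h1 h2, siteDeriv_smul_of_contDiff hF, siteDeriv_smul_of_contDiff hG]
  simp only [Pi.sub_apply, Pi.smul_apply, smul_eq_mul]

/-- Product rule with a coordinate: `D_{k,v}(scoord κ · G) = (D scoord κ) G + scoord κ · D G`. -/
theorem siteDeriv_scoord_mul {G : (Λ → E) → ℝ} (hG : ContDiff ℝ ∞ G) (κ : SiteCoord Λ E) (k : Λ)
    (v : E) (x : Λ → E) : siteDeriv k v (scoord κ * G) x =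
      (if κ.1 = k then ⟪stdOrthonormalBasis ℝ E κ.2, v⟫ else 0) * G x +
        scoord κ x * siteDeriv k v G x := by
  rw [siteDeriv_mul v (differentiableAt_section (contDiff_scoord κ) x k _)
    (differentiableAt_section hG x k _), siteDeriv_scoord]

/-- **Site derivatives of `R_N`, `I_N`** (`d(a+ib)^N = N (a+ib)^{N−1} (α + iβ)`):
`D_{k,v} R_N = N (α R_{N−1} − β I_{N−1})`, `D_{k,v} I_N = N (α I_{N−1} + β R_{N−1})` with
`α = δ_{n₀ k} ⟪b i₀, v⟫`, `β = δ_{n₀ k} ⟪b i₁, v⟫`. -/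
theorem siteDeriv_zpow (k : Λ) (v : E) : ∀ N : ℕ, ∀ x : Λ → E,
    siteDeriv k v (reZpow n₀ i₀ i₁ N) x =
      N * ((if n₀ = k then ⟪stdOrthonormalBasis ℝ E i₀, v⟫ else 0) * reZpow n₀ i₀ i₁ (N - 1) x -
        (if n₀ = k then ⟪stdOrthonormalBasis ℝ E i₁, v⟫ else 0) * imZpow n₀ i₀ i₁ (N - 1) x) ∧
    siteDeriv k v (imZpow n₀ i₀ i₁ N) x =
      N * ((if n₀ = k then ⟪stdOrthonormalBasis ℝ E i₀, v⟫ else 0) * imZpow n₀ i₀ i₁ (N - 1) x +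
        (if n₀ = k then ⟪stdOrthonormalBasis ℝ E i₁, v⟫ else 0) * reZpow n₀ i₀ i₁ (N - 1) x)
  | 0, x => by
      simp only [reZpow_zero, imZpow_zero, siteDeriv_const, Pi.zero_apply, Nat.cast_zero, zero_mul,
        and_self]
  | N + 1, x => by
      have hR := (contDiff_zpow n₀ i₀ i₁ N).1
      have hI := (contDiff_zpow n₀ i₀ i₁ N).2
      have ihR := fun y => (siteDeriv_zpow k v N y).1; have ihI := fun y => (siteDeriv_zpow k v N y).2
      have hm : ∀ (κ : SiteCoord Λ E) {G : (Λ → E) → ℝ}, ContDiff ℝ ∞ G →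
          ContDiff ℝ ∞ (scoord κ * G) := fun κ G hG => (contDiff_scoord κ).mul hG
      have hA := hm (n₀, i₀) hR; have hB := hm (n₀, i₁) hI
      have hC := hm (n₀, i₀) hI; have hD := hm (n₀, i₁) hR
      rw [reZpow_succ, imZpow_succ, siteDeriv_sub_of_contDiff hA hB, siteDeriv_add_of_contDiff hC hD]
      simp only [Pi.sub_apply, Pi.add_apply, siteDeriv_scoord_mul hR,
        siteDeriv_scoord_mul hI, ihR, ihI, Nat.add_sub_cancel, Nat.cast_add, Nat.cast_one]
      rcases N with _ | M
      · simp
      · simp only [reZpow_succ, imZpow_succ, Pi.sub_apply, Pi.add_apply, Pi.mul_apply,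
          Nat.add_sub_cancel, Nat.cast_add, Nat.cast_one]
        constructor <;> ring

/-- **Euler**: `E_k R_N = δ_{n₀ k} N R_N`. -/
theorem siteEuler_reZpow (k : Λ) (N : ℕ) (x : Λ → E) :
    siteEuler k (reZpow n₀ i₀ i₁ N) x = (if n₀ = k then (N : ℝ) else 0) * reZpow n₀ i₀ i₁ N x := by
  rw [siteEuler, (siteDeriv_zpow n₀ i₀ i₁ k (x k) N x).1]
  rcases N with _ | M
  · simp
  · by_cases hk : n₀ = k
    · subst hk
      simp only [if_true, reZpow_succ, Pi.sub_apply, Pi.mul_apply, scoord, Nat.add_sub_cancel,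
        Nat.cast_add, Nat.cast_one]
    · simp [hk]

/-- As functions: `E_k R_N = (δ_{n₀k} N) • R_N`. -/
theorem siteEuler_reZpow_eq_smul (k : Λ) (N : ℕ) :
    siteEuler k (reZpow n₀ i₀ i₁ N) = (if n₀ = k then (N : ℝ) else 0) • reZpow n₀ i₀ i₁ N := by
  funext x; rw [siteEuler_reZpow, Pi.smul_apply, smul_eq_mul]

/-- `D_{k,b_i} R_N` as a function: a combination of `R_{N−1}`, `I_{N−1}` with constant coefficients. -/
theorem siteDeriv_reZpow_eq (k : Λ) (i : Fin (Module.finrank ℝ E)) (N : ℕ) :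
    siteDeriv k (stdOrthonormalBasis ℝ E i) (reZpow n₀ i₀ i₁ N) =
      ((N : ℝ) * (if n₀ = k then ⟪stdOrthonormalBasis ℝ E i₀, stdOrthonormalBasis ℝ E i⟫ else 0)) •
          reZpow n₀ i₀ i₁ (N - 1) -
        ((N : ℝ) * (if n₀ = k then ⟪stdOrthonormalBasis ℝ E i₁, stdOrthonormalBasis ℝ E i⟫ else 0)) •
          imZpow n₀ i₀ i₁ (N - 1) := by
  funext x
  rw [(siteDeriv_zpow n₀ i₀ i₁ k _ N x).1]
  simp only [Pi.sub_apply, Pi.smul_apply, smul_eq_mul]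
  ring

/-- **HARMONICITY: `Σ_i D_{k,b_i} D_{k,b_i} R_N = 0`** (`i₀ ≠ i₁`): the second derivatives give
`N(N−1)[(Σ_i α_i² − Σ_i β_i²) R_{N−2} − 2(Σ_i α_i β_i) I_{N−2}]` and, by orthonormality of the frame,
`Σ_i α_i² = Σ_i β_i² = δ_{n₀k}`, `Σ_i α_i β_i = 0`. -/
theorem siteFlatLap_reZpow (h : i₀ ≠ i₁) (k : Λ) (N : ℕ) (x : Λ → E) :
    siteFlatLap k (reZpow n₀ i₀ i₁ N) x = 0 := by
  have hR := (contDiff_zpow n₀ i₀ i₁ (N - 1)).1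
  have hI := (contDiff_zpow n₀ i₀ i₁ (N - 1)).2
  -- second derivatives
  have h2 : ∀ i, siteDeriv k (stdOrthonormalBasis ℝ E i)
      (siteDeriv k (stdOrthonormalBasis ℝ E i) (reZpow n₀ i₀ i₁ N)) x =
      (N : ℝ) * ((N - 1 : ℕ) : ℝ) *
        (((if n₀ = k then ⟪stdOrthonormalBasis ℝ E i₀, stdOrthonormalBasis ℝ E i⟫ else 0) ^ 2 -
            (if n₀ = k then ⟪stdOrthonormalBasis ℝ E i₁, stdOrthonormalBasis ℝ E i⟫ else 0) ^ 2) *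
            reZpow n₀ i₀ i₁ (N - 1 - 1) x -
          2 * ((if n₀ = k then ⟪stdOrthonormalBasis ℝ E i₀, stdOrthonormalBasis ℝ E i⟫ else 0) *
              (if n₀ = k then ⟪stdOrthonormalBasis ℝ E i₁, stdOrthonormalBasis ℝ E i⟫ else 0)) *
            imZpow n₀ i₀ i₁ (N - 1 - 1) x) := by
    intro i
    rw [siteDeriv_reZpow_eq, siteDeriv_smul_sub_smul hR hI, (siteDeriv_zpow n₀ i₀ i₁ k _ (N - 1) x).1,
      (siteDeriv_zpow n₀ i₀ i₁ k _ (N - 1) x).2]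
    ring
  unfold siteFlatLap
  simp_rw [h2]
  by_cases hk : n₀ = k
  · subst hk
    simp only [if_true]
    -- orthonormality sums
    have eι : ∀ i j : Fin (Module.finrank ℝ E),
        ⟪stdOrthonormalBasis ℝ E i, stdOrthonormalBasis ℝ E j⟫ = if i = j then (1 : ℝ) else 0 :=
      fun i j => (stdOrthonormalBasis ℝ E).inner_eq_ite i j
    have hαα : ∑ i, ⟪stdOrthonormalBasis ℝ E i₀, stdOrthonormalBasis ℝ E i⟫ ^ 2 = 1 := by
      simp_rw [eι]
      rw [Finset.sum_eq_single i₀ (fun j _ hj => by simp [Ne.symm hj]) (by simp)]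
      simp
    have hββ : ∑ i, ⟪stdOrthonormalBasis ℝ E i₁, stdOrthonormalBasis ℝ E i⟫ ^ 2 = 1 := by
      simp_rw [eι]
      rw [Finset.sum_eq_single i₁ (fun j _ hj => by simp [Ne.symm hj]) (by simp)]
      simp
    have hαβ : ∑ i, ⟪stdOrthonormalBasis ℝ E i₀, stdOrthonormalBasis ℝ E i⟫ *
        ⟪stdOrthonormalBasis ℝ E i₁, stdOrthonormalBasis ℝ E i⟫ = 0 := by
      simp_rw [eι]
      exact Finset.sum_eq_zero fun j _ => by
        by_cases h0 : i₀ = j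
        · subst h0; simp [Ne.symm h]
        · simp [h0]
    have e : ∀ i, (N : ℝ) * ((N - 1 : ℕ) : ℝ) *
        ((⟪stdOrthonormalBasis ℝ E i₀, stdOrthonormalBasis ℝ E i⟫ ^ 2 -
            ⟪stdOrthonormalBasis ℝ E i₁, stdOrthonormalBasis ℝ E i⟫ ^ 2) *
            reZpow n₀ i₀ i₁ (N - 1 - 1) x -
          2 * (⟪stdOrthonormalBasis ℝ E i₀, stdOrthonormalBasis ℝ E i⟫ *
              ⟪stdOrthonormalBasis ℝ E i₁, stdOrthonormalBasis ℝ E i⟫) *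
            imZpow n₀ i₀ i₁ (N - 1 - 1) x) =
        (N : ℝ) * ((N - 1 : ℕ) : ℝ) * reZpow n₀ i₀ i₁ (N - 1 - 1) x *
            ⟪stdOrthonormalBasis ℝ E i₀, stdOrthonormalBasis ℝ E i⟫ ^ 2 -
          (N : ℝ) * ((N - 1 : ℕ) : ℝ) * reZpow n₀ i₀ i₁ (N - 1 - 1) x *
            ⟪stdOrthonormalBasis ℝ E i₁, stdOrthonormalBasis ℝ E i⟫ ^ 2 -
          2 * (N : ℝ) * ((N - 1 : ℕ) : ℝ) * imZpow n₀ i₀ i₁ (N - 1 - 1) x *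
            (⟪stdOrthonormalBasis ℝ E i₀, stdOrthonormalBasis ℝ E i⟫ *
              ⟪stdOrthonormalBasis ℝ E i₁, stdOrthonormalBasis ℝ E i⟫) := fun i => by ring
    simp_rw [e]
    rw [Finset.sum_sub_distrib, Finset.sum_sub_distrib, ← Finset.mul_sum, ← Finset.mul_sum,
      ← Finset.mul_sum, hαα, hββ, hαβ]
    ring
  · simp [hk]

/-- **`𝔏 R_N = N(N + d − 2) · R_N` AS FUNCTIONS ON `Λ → E`** (harmonicity kills the flat part; Euler
twice gives `N² + (d−2)N` at the site `n₀` and `0` elsewhere). -/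
theorem sum_ambSiteLap_reZpow (h : i₀ ≠ i₁) (N : ℕ) (x : Λ → E) :
    -∑ k, ambSiteLap k (reZpow n₀ i₀ i₁ N) x =
      (N : ℝ) * (N + (Module.finrank ℝ E : ℝ) - 2) * reZpow n₀ i₀ i₁ N x := by
  have hE2 : ∀ k, siteEuler k (siteEuler k (reZpow n₀ i₀ i₁ N)) x =
      (if n₀ = k then (N : ℝ) else 0) ^ 2 * reZpow n₀ i₀ i₁ N x := by
    intro k
    rw [siteEuler_reZpow_eq_smul, siteEuler_smul_of_contDiff (contDiff_zpow n₀ i₀ i₁ N).1,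
      siteEuler_reZpow_eq_smul]
    simp only [Pi.smul_apply, smul_eq_mul]
    ring
  simp only [ambSiteLap, siteFlatLap_reZpow n₀ i₀ i₁ h, hE2, siteEuler_reZpow, zero_sub]
  have e : ∀ k, -((if n₀ = k then (N : ℝ) else 0) ^ 2 * reZpow n₀ i₀ i₁ N x) -
      ((Module.finrank ℝ E : ℝ) - 2) * ((if n₀ = k then (N : ℝ) else 0) * reZpow n₀ i₀ i₁ N x) =
      if n₀ = k then -((N : ℝ) * (N + (Module.finrank ℝ E : ℝ) - 2) * reZpow n₀ i₀ i₁ N x) else 0 :=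
    fun k => by split_ifs <;> ring
  simp_rw [e]
  rw [Finset.sum_ite_eq, if_pos (Finset.mem_univ _), neg_neg]

/-- **`polyLap N R_N = N(N + d − 2) • R_N`: `R_N` IS AN EIGENVECTOR OF `𝔏₀` ON `polyS N`.** -/
theorem polyLap_reZpow (h : i₀ ≠ i₁) (N : ℕ) :
    polyLap Λ E N ⟨reZpow n₀ i₀ i₁ N, reZpow_mem_polyS n₀ i₀ i₁ N⟩ =
      ((N : ℝ) * (N + (Module.finrank ℝ E : ℝ) - 2)) •
        ⟨reZpow n₀ i₀ i₁ N, reZpow_mem_polyS n₀ i₀ i₁ N⟩ := by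
  apply Subtype.ext
  funext x
  rw [polyLap_apply, Submodule.coe_smul, Pi.smul_apply, smul_eq_mul]
  exact sum_ambSiteLap_reZpow n₀ i₀ i₁ h N x

end Derivatives

/-! ## §3 The top label is an eigenvalue; the Bernstein constant is sharp -/

section Sharp

variable [Fintype Λ] [DecidableEq Λ]

/-- **`N(N + d − 2)` IS AN EIGENVALUE OF `𝔏₀` ON `polyS N`** (`d ≥ 2`, `Λ` nonempty): the top of the
list of labels of `SphereLatticeLaplacianSpectrum` is attained, for every `N` and every volume. -/
theorem hasEigenvalue_polyLap_top [Nonempty Λ] (h2 : 2 ≤ Module.finrank ℝ E) (N : ℕ) :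
    Module.End.HasEigenvalue (polyLap Λ E N) ((N : ℝ) * (N + (Module.finrank ℝ E : ℝ) - 2)) := by
  obtain ⟨n₀⟩ := ‹Nonempty Λ›
  set i₀ : Fin (Module.finrank ℝ E) := ⟨0, by omega⟩; set i₁ : Fin (Module.finrank ℝ E) := ⟨1, by omega⟩
  have h01 : i₀ ≠ i₁ := by simp [i₀, i₁, Fin.ext_iff]
  refine Module.End.hasEigenvalue_of_hasEigenvector (x := ⟨reZpow n₀ i₀ i₁ N, reZpow_mem_polyS _ _ _ N⟩)
    ⟨Module.End.mem_eigenspace_iff.2 (polyLap_reZpow n₀ i₀ i₁ h01 N), fun h0 => ?_⟩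
  have := congrFun (congrArg Subtype.val h0) (fun _ => stdOrthonormalBasis ℝ E i₀)
  rw [Submodule.coe_zero, Pi.zero_apply] at this
  exact one_ne_zero ((zpow_frame n₀ i₀ i₁ h01 N).1.symm.trans this)

/-- **On the product of unit spheres**: a lattice polynomial of degree `≤ N`, not identically zero on
`Ω`, with `−Σ_k ∂̃_k·∂̃_k f = N(N + d − 2) f` there (`d ≥ 2`, `Λ` nonempty). -/
theorem exists_sphere_eigenfunction_top [Nonempty Λ] (h2 : 2 ≤ Module.finrank ℝ E) (N : ℕ) :
    ∃ f ∈ polyS Λ E N, (∃ ξ : Λ → sphere (0 : E) 1, f (fun n => (ξ n : E)) ≠ 0) ∧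
      ∀ ξ : Λ → sphere (0 : E) 1, -∑ k, siteLaplacian k f (fun n => (ξ n : E)) =
        (N : ℝ) * (N + (Module.finrank ℝ E : ℝ) - 2) * f (fun n => (ξ n : E)) := by
  obtain ⟨n₀⟩ := ‹Nonempty Λ›
  set i₀ : Fin (Module.finrank ℝ E) := ⟨0, by omega⟩
  set i₁ : Fin (Module.finrank ℝ E) := ⟨1, by omega⟩
  have h01 : i₀ ≠ i₁ := by simp [i₀, i₁, Fin.ext_iff]
  have hmem : (stdOrthonormalBasis ℝ E i₀ : E) ∈ sphere (0 : E) 1 := by simp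
  refine ⟨reZpow n₀ i₀ i₁ N, reZpow_mem_polyS _ _ _ N, ⟨fun _ => ⟨_, hmem⟩, ?_⟩, fun ξ => ?_⟩
  · rw [(zpow_frame n₀ i₀ i₁ h01 N).1]; exact one_ne_zero
  · have h := polyLap_apply_sphere (⟨reZpow n₀ i₀ i₁ N, reZpow_mem_polyS _ _ _ N⟩ : polyS Λ E N) ξ
    rw [polyLap_reZpow n₀ i₀ i₁ h01 N, Submodule.coe_smul, Pi.smul_apply, smul_eq_mul] at h
    exact h.symm

variable [MeasurableSpace E] [BorelSpace E]

/-- **THE BERNSTEIN CONSTANT IS SHARP FOR EVERY VOLUME.**  For `d ≥ 2`, `Λ` nonempty and every `N`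
there is a lattice polynomial `f` of degree `≤ N` with `∫ f² dπ > 0` and
`Σ_k ∫ ‖∂̃_k f‖² dπ = N (N + d − 2) · ∫ f² dπ` — equality in `bernstein_polyS`. -/
theorem bernstein_polyS_sharp [Nonempty Λ] (h2 : 2 ≤ Module.finrank ℝ E) (N : ℕ) :
    ∃ f ∈ polyS Λ E N,
      0 < ∫ ξ, f (fun n => ((ξ : Λ → sphere (0 : E) 1) n : E)) ^ 2
          ∂Measure.pi (fun _ : Λ => (volume : Measure E).toSphere) ∧
      ∑ k, ∫ ξ, ‖siteGrad k f (fun n => ((ξ : Λ → sphere (0 : E) 1) n : E))‖ ^ 2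
          ∂Measure.pi (fun _ : Λ => (volume : Measure E).toSphere) =
        (N : ℝ) * (N + (Module.finrank ℝ E : ℝ) - 2) *
          ∫ ξ, f (fun n => ((ξ : Λ → sphere (0 : E) 1) n : E)) ^ 2
            ∂Measure.pi (fun _ : Λ => (volume : Measure E).toSphere) := by
  haveI : Nontrivial E := Module.nontrivial_of_finrank_pos (R := ℝ) (by omega)
  obtain ⟨n₀⟩ := ‹Nonempty Λ›
  set i₀ : Fin (Module.finrank ℝ E) := ⟨0, by omega⟩
  set i₁ : Fin (Module.finrank ℝ E) := ⟨1, by omega⟩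
  have h01 : i₀ ≠ i₁ := by simp [i₀, i₁, Fin.ext_iff]
  set f : polyS Λ E N := ⟨reZpow n₀ i₀ i₁ N, reZpow_mem_polyS _ _ _ N⟩
  have hL : LΩ Λ E N (toV Λ E N f) = ((N : ℝ) * (N + (Module.finrank ℝ E : ℝ) - 2)) • toV Λ E N f := by
    rw [LΩ_toV, polyLap_reZpow n₀ i₀ i₁ h01 N, map_smul]
  have hne : toV Λ E N f ≠ 0 := by
    intro h0
    have hmem : (stdOrthonormalBasis ℝ E i₀ : E) ∈ sphere (0 : E) 1 := by simp
    have := congrFun (congrArg (fun v : VΩ Λ E N => (v : (Λ → sphere (0 : E) 1) → ℝ)) h0)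
      (fun _ => ⟨_, hmem⟩)
    rw [toV_apply, VΩ.zero_apply] at this
    exact one_ne_zero (((zpow_frame n₀ i₀ i₁ h01 N).1).symm.trans this)
  refine ⟨reZpow n₀ i₀ i₁ N, reZpow_mem_polyS _ _ _ N, ?_, ?_⟩
  · rw [← norm_toV_sq f]
    positivity
  · rw [← norm_toV_sq f, ← inner_LΩ_self f, hL, real_inner_smul_right, real_inner_self_eq_norm_sq]

omit [MeasurableSpace E] [BorelSpace E] in
/-- **The gap label `d − 1` is attained** (`N = 1`: site-linear functionals, E–S's display before
eq. (15)): `d − 1` is an eigenvalue of `𝔏₀` on `polyS 1`, so the gap of `poincare`-type bounds is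
optimal for every volume as well. -/
theorem gap_label_attained [Nonempty Λ] (h2 : 2 ≤ Module.finrank ℝ E) :
    Module.End.HasEigenvalue (polyLap Λ E 1) ((Module.finrank ℝ E : ℝ) - 1) := by
  have h := hasEigenvalue_polyLap_top (Λ := Λ) (E := E) h2 1
  have e : ((1 : ℕ) : ℝ) * ((1 : ℕ) + (Module.finrank ℝ E : ℝ) - 2) =
      (Module.finrank ℝ E : ℝ) - 1 := by push_cast; ring
  rwa [e] at h

end Sharp

end Summit.Ventures.LatticeQCDFlow.Exactness

end
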